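import Literature.NumberTheory.EllipticCurves.KatoTwistedFinitenessEulerFactorsProofs
import Literature.NumberTheory.EllipticCurves.Kato2004.EulerSystemValues
import HarnessLib

/-!
# The value at `s = 1` of Kato's DEPLETED twisted `L`-function: finite Euler-factor removal
# (T-PORT-1 §3 (P-KIM), brick PK-L `KatoDepletedLValue` = K-i's 'finite Euler-factor removal';
# cell `b2b-bsdres`, team n1011, seat p02 gen 11; TOOL)

HONEST FRAMING (cell `b2b-bsdres`, run/shared/lean/b2b/bsd-rank1-residual/, verbatim in every
file): the goal of the cell is to DELETE the COMBINATION-SHAPED residual classes of the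
Birch–Swinnerton-Dyer formula for ALL analytic-rank `≤ 1` elliptic curves over `ℚ` — "full BSD
formula for every rank `≤ 1` curve in class `C`" assembled STRICTLY from published theorems — so
that the rank-`≤ 1` remainder becomes exactly the CONSTRUCTION-SHAPED classes, which are TYPED
(missing-input `Prop`s), NOT attempted. This is not "finishing BSD". Team n1011 (N10 / N11):
research route on the CONSTRUCTION-SHAPED class X4 / §I N11 (route-1 PORT of record, DICT3₁);
TOOL theorems only (no definition, no named fact); nothing is booked; no mark / label / flag text
moves.

## What this file proves

`ZetaBody`'s value law (C5) speaks of an entire continuation `Lχ` of the `(p·A)`-DEPLETED twisted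
series (`Kato2004.EulerSystemValues.IsDepletedTwistedL f m (p·A) χ Lχ`: `Lχ` entire and equal on
`re s > 2` to `twistedLSeries f (χ.changeLevel (dvd_mul_right m (p·A))) s`), while Birch's lemma and
the Mazur–Tate dictionary speak of the UNdepleted series of `χ`.  The tree already holds the
removal of finitely many Euler factors on the half-plane of convergence
(`twistedLSeries_changeLevel_eq_prod_mul`, Hecke's recursion) and its identity-theorem transport
in the `≠ 0` currency (`exists_continuation_changeLevel_iff`).  This file states the VALUE form the
PORT consumes (r1 ROUTE-1 §53.5 chain: C5 → Fourier inversion (PK-2) → [depletion, THIS] → Birch /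
induced characters → θ̃-value):

* `continuation_changeLevel_eq_eulerFactors_mul` — for a newform `f ∈ S₂(Γ₀(N))`, `χ` mod `m`,
  `χ̃ = changeLevel χ` mod `M` (`m ∣ M`): ANY entire continuation `L` of the `χ̃`-series is the
  entire product `P · L₀` of the removed Euler factors
  `P(s) = ∏_{q ∣ M, q ∤ m} (1 − χ(q) a_q q⁻ˢ + 𝟙_N(q) χ(q)² q·q⁻²ˢ)` with ANY entire continuation
  `L₀` of the `χ`-series (as FUNCTIONS; identity theorem on `ℂ`);
* `continuation_changeLevel_one_eq` — hence **`L 1 = P(1) · L₀ 1`**;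
* **`depletedTwistedL_one_eq`** — the same with the hypothesis in `ZetaBody`'s shape
  `IsDepletedTwistedL f m M χ L` (depletion at the primes of `M` not dividing `m`);
* `depletedTwistedL_one_eq_trivial` — the END-m1 case `m = 1`, `χ = 1`: `L 1 = ∏_{q ∣ M}(…) · L₀ 1`
  with `L₀` any entire continuation of `cuspFormLSeries f` (PK-6-m1's input);
* `continuation_one_eq_eulerFactors_mul_primitive` — the same from ANY `χ` mod `M` down to its
  PRIMITIVE character `χ₀` (Birch's lemma wants `χ₀`; `changeLevel_primitiveCharacter`);
* `eulerFactor_eq_one_of_dvd_modulus` — at a prime of the modulus of `χ` the factor is `1`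
  (`χ(q) = 0`): nothing is removed there;
* `eulerFactor_eq_one_of_cuspCoeff_eq_zero`, `cuspCoeff_eq_zero_of_LFunction_eq_zero` — at a
  prime `q ∣ N` with `a_q = 0`, in particular at an ADDITIVE prime of `E` when `f` is its newform
  (`IsNewformOf W f`; `a_q(E) = 0` by the tree's `LFunction_apply_eq_zero_of_hasAdditiveReductionAt`),
  the removed factor is `1` ("3-depletion is free at additive 3", T-PORT-1-PKIM (S5)); combined
  curve-currency form `eulerFactor_eq_one_of_LFunction_eq_zero (hf : IsNewformOf W f)
  (hap : W.LFunction p = 0) (hpN : p ∣ N)`;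
* `eulerFactor_one_eq_card_div` — at a prime `q ∤ N` with `χ(q) = 1` the factor at `s = 1` is
  `(q + 1 − a_q)/q` (= `#Ẽ(𝔽_q)/q`, the augmentation of Kato's `(13.1.1)` depletion element);
* §4 RATIONAL FORM for PK-6-m1's displayed `hdepl : LA 1 = (E : ℂ) * Lf 1` (p13 GEN 13):
  `eulerFactor_one_eq_ratCast`, `depletedTwistedL_one_eq_ratCast_prod_mul`
  (`E = ∏_{q ∣ M} (1 − a_q(W)/q + 𝟙_N(q)/q) : ℚ`) and
  `depletedTwistedL_one_eq_ratCast_prod_mul_of_apZero` (`M = p·A`, `a_p(W) = 0`, `p ∣ N`: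
  `E = ∏_{q ∣ A} (…)`) — `E ≠ 0` and `ord_p E = 0` stay the row's certificates.

References (context): K. Kato, Astérisque 295 (2004) §6.2 (p. 161), (13.1.1), Ex. 13.3;
F. Diamond–J. Shurman, GTM 228, Prop. 5.8.5, (8.44).
-/

noncomputable section

open scoped BigOperators

open Complex CongruenceSubgroup

namespace Summit.BirchSwinnertonDyer.Rank1Residual.GaloisImage.DepletedLValue

open Literature.NumberTheory.EllipticCurves Literature.NumberTheory.EllipticCurves.ModularForms
  Literature.NumberTheory.EllipticCurves.Kato2004

variable {N : ℕ} [NeZero N] {m M : ℕ} [NeZero M]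

/-! ### §1. Two continuations differ by the removed Euler factors -/

/-- **Continuations of the inflated series = Euler factors × continuations of the series.** For a
newform `f ∈ S₂(Γ₀(N))`, `χ` mod `m`, `m ∣ M`: if `L` is entire and equals
`twistedLSeries f (changeLevel χ) s` on `re s > 2`, and `L₀` is entire and equals
`twistedLSeries f χ s` there, then `L = P · L₀` everywhere, `P` the (entire) product of the removed
Euler factors at the primes of `M` not dividing `m` — `twistedLSeries_changeLevel_eq_prod_mul` on the
half-plane and the identity theorem on `ℂ`. [cite: Kato2004Asterisque, §6.2 (p. 161)] -/
theorem continuation_changeLevel_eq_eulerFactors_mul {f : CuspForm (Gamma0 N) 2} (hf : IsNewform0 f)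
    (hd : m ∣ M) (χ : DirichletCharacter ℂ m) {L L₀ : ℂ → ℂ} (hL : Differentiable ℂ L)
    (hLs : ∀ s : ℂ, 2 < s.re → L s = twistedLSeries f (DirichletCharacter.changeLevel hd χ) s)
    (hL₀ : Differentiable ℂ L₀) (hL₀s : ∀ s : ℂ, 2 < s.re → L₀ s = twistedLSeries f χ s) :
    L = fun s => (∏ p ∈ M.primeFactors.filter (fun p => ¬ p ∣ m),
        (1 - χ (p : ZMod m) * cuspCoeff f p * (p : ℂ) ^ (-s) +
          (if p ∣ N then 0 else (p : ℂ)) * χ (p : ZMod m) ^ 2 * ((p : ℂ) ^ (-s)) ^ 2)) * L₀ s := by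
  have hS : ∀ p ∈ M.primeFactors.filter (fun p => ¬ p ∣ m), p.Prime := fun p hp =>
    Nat.prime_of_mem_primeFactors (Finset.mem_filter.mp hp).1
  have hPd := differentiable_eulerFactors f χ hS
  refine AnalyticOnNhd.eq_of_eventuallyEq (z₀ := (3 : ℂ))
    (hL.differentiableOn.analyticOnNhd isOpen_univ)
    ((hPd.mul hL₀).differentiableOn.analyticOnNhd isOpen_univ) ?_
  have hopen : IsOpen {s : ℂ | 2 < s.re} := isOpen_lt continuous_const Complex.continuous_re
  have hmem : (3 : ℂ) ∈ {s : ℂ | 2 < s.re} := by simp; norm_num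
  filter_upwards [hopen.mem_nhds hmem] with s hs
  rw [hLs s hs, hL₀s s hs, twistedLSeries_changeLevel_eq_prod_mul hf hd χ hs]

/-- **At `s = 1`**: `L(1) = ∏_{q ∣ M, q ∤ m} (1 − χ(q) a_q q⁻¹ + 𝟙_N(q) χ(q)² q·q⁻²) · L₀(1)` for
any two entire continuations as above. [cite: Kato2004Asterisque, §6.2 (p. 161)] -/
theorem continuation_changeLevel_one_eq {f : CuspForm (Gamma0 N) 2} (hf : IsNewform0 f)
    (hd : m ∣ M) (χ : DirichletCharacter ℂ m) {L L₀ : ℂ → ℂ} (hL : Differentiable ℂ L)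
    (hLs : ∀ s : ℂ, 2 < s.re → L s = twistedLSeries f (DirichletCharacter.changeLevel hd χ) s)
    (hL₀ : Differentiable ℂ L₀) (hL₀s : ∀ s : ℂ, 2 < s.re → L₀ s = twistedLSeries f χ s) :
    L 1 = (∏ p ∈ M.primeFactors.filter (fun p => ¬ p ∣ m),
        (1 - χ (p : ZMod m) * cuspCoeff f p * (p : ℂ) ^ (-(1 : ℂ)) +
          (if p ∣ N then 0 else (p : ℂ)) * χ (p : ZMod m) ^ 2 * ((p : ℂ) ^ (-(1 : ℂ))) ^ 2)) *
      L₀ 1 := by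
  rw [continuation_changeLevel_eq_eulerFactors_mul hf hd χ hL hLs hL₀ hL₀s]

/-! ### §2. The `ZetaBody` shape: `IsDepletedTwistedL` -/

/-- **Kato's depleted value at `1`.** In the currency of `ZetaBody` (C5): if
`IsDepletedTwistedL f m M χ L` (`L` entire, equal on `re s > 2` to the series of `χ` inflated to
modulus `m·M`, i.e. depleted at the primes of `M`) and `L₀` is an entire continuation of the
series of `χ` itself, then
`L 1 = ∏_{q ∣ mM, q ∤ m} (1 − χ(q) a_q q⁻¹ + 𝟙_N(q) χ(q)² q·q⁻²) · L₀ 1`.  (At `m`-coprime primes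
of `M` only; at the primes of `m` nothing is removed since `χ` vanishes there.)
[cite: Kato2004Asterisque, §6.2 (p. 161) and Ex. 13.3 (p. 225)] -/
theorem depletedTwistedL_one_eq [NeZero m] {f : CuspForm (Gamma0 N) 2} (hf : IsNewform0 f)
    (χ : DirichletCharacter ℂ m) {L L₀ : ℂ → ℂ}
    (hS : EulerSystemValues.IsDepletedTwistedL f m M χ L)
    (hL₀ : Differentiable ℂ L₀) (hL₀s : ∀ s : ℂ, 2 < s.re → L₀ s = twistedLSeries f χ s) :
    L 1 = (∏ p ∈ (m * M).primeFactors.filter (fun p => ¬ p ∣ m),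
        (1 - χ (p : ZMod m) * cuspCoeff f p * (p : ℂ) ^ (-(1 : ℂ)) +
          (if p ∣ N then 0 else (p : ℂ)) * χ (p : ZMod m) ^ 2 * ((p : ℂ) ^ (-(1 : ℂ))) ^ 2)) *
      L₀ 1 :=
  continuation_changeLevel_one_eq hf (dvd_mul_right m M) χ hS.1 hS.2 hL₀ hL₀s

/-- **The END-m1 case (`m = 1`, trivial character, depletion at the primes of `M = p·A`).** For a
newform `f`, an entire `L` with `IsDepletedTwistedL f 1 M 1 L` (i.e. `L` continues
`∑_{(n,M)=1} aₙ n⁻ˢ`) and an entire continuation `L₀` of `L(f, s) = cuspFormLSeries f`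
(e.g. `W.entireLFunction` when `f` is the newform of `W`):
`L 1 = ∏_{q ∣ M} (1 − a_q q⁻¹ + 𝟙_N(q) q·q⁻²) · L₀ 1` — the first PK-6 target (r1 §53.6 R1-68, PK-6-m1:
`D_∅ = 1`, level `m = 1`). [cite: Kato2004Asterisque, §6.2 (p. 161) and Ex. 13.3 (p. 225)] -/
theorem depletedTwistedL_one_eq_trivial {f : CuspForm (Gamma0 N) 2} (hf : IsNewform0 f)
    {L L₀ : ℂ → ℂ} (hS : EulerSystemValues.IsDepletedTwistedL f 1 M (1 : DirichletCharacter ℂ 1) L)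
    (hL₀ : Differentiable ℂ L₀) (hL₀s : ∀ s : ℂ, 2 < s.re → L₀ s = cuspFormLSeries f s) :
    L 1 = (∏ p ∈ M.primeFactors,
        (1 - cuspCoeff f p * (p : ℂ) ^ (-(1 : ℂ)) +
          (if p ∣ N then 0 else (p : ℂ)) * ((p : ℂ) ^ (-(1 : ℂ))) ^ 2)) * L₀ 1 := by
  have h := depletedTwistedL_one_eq (m := 1) (M := M) hf (1 : DirichletCharacter ℂ 1) hS hL₀
    (fun s hs => by rw [hL₀s s hs, twistedLSeries_one_eq_cuspFormLSeries_of_one])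
  rw [h, one_mul]
  congr 1
  refine Finset.prod_congr ?_ fun p _ => ?_
  · ext p
    simp only [Finset.mem_filter, and_iff_left_iff_imp]
    exact fun hp => (Nat.prime_of_mem_primeFactors hp).one_lt.ne' ∘ Nat.dvd_one.mp
  · rw [MulChar.one_apply (isUnit_of_subsingleton _)]
    ring

/-- **Down to the PRIMITIVE character** (Birch's lemma wants `χ₀` primitive): for ANY Dirichlet
character `χ` mod `M` with primitive character `χ₀` of conductor `m₀` (Mathlib `primitiveCharacter`,
`changeLevel_primitiveCharacter : changeLevel _ χ₀ = χ`), an entire continuation `L` of the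
`χ`-series and an entire continuation `L₀` of the `χ₀`-series satisfy
`L 1 = ∏_{q ∣ M, q ∤ m₀} (1 − χ₀(q) a_q q⁻¹ + 𝟙_N(q) χ₀(q)² q·q⁻²) · L₀ 1` (p13 / r1 GEN 42:
'strip χ to χ₀ before Birch'; no Gauss sum is divided by here — lit-kato §30).
[cite: Kato2004Asterisque, §6.2 (p. 161)] -/
theorem continuation_one_eq_eulerFactors_mul_primitive {f : CuspForm (Gamma0 N) 2}
    (hf : IsNewform0 f) (χ : DirichletCharacter ℂ M) {L L₀ : ℂ → ℂ} (hL : Differentiable ℂ L)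
    (hLs : ∀ s : ℂ, 2 < s.re → L s = twistedLSeries f χ s) (hL₀ : Differentiable ℂ L₀)
    (hL₀s : ∀ s : ℂ, 2 < s.re → L₀ s = twistedLSeries f χ.primitiveCharacter s) :
    L 1 = (∏ p ∈ M.primeFactors.filter (fun p => ¬ p ∣ χ.conductor),
        (1 - χ.primitiveCharacter (p : ZMod χ.conductor) * cuspCoeff f p * (p : ℂ) ^ (-(1 : ℂ)) +
          (if p ∣ N then 0 else (p : ℂ)) * χ.primitiveCharacter (p : ZMod χ.conductor) ^ 2 *
            ((p : ℂ) ^ (-(1 : ℂ))) ^ 2)) * L₀ 1 := by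
  refine continuation_changeLevel_one_eq hf χ.conductor_dvd_level χ.primitiveCharacter hL
    (fun s hs => ?_) hL₀ hL₀s
  rw [DirichletCharacter.changeLevel_primitiveCharacter]
  exact hLs s hs

/-! ### §3. The removed factors at special primes -/

omit [NeZero N] [NeZero M] in
/-- **At a prime of the modulus of `χ` nothing is removed**: if `q ∣ m` (`q` prime) then
`χ(q) = 0` and the factor at `q` is `1` — which is why the removed product runs over the primes
of `M` NOT dividing `m` only. [folklore] -/
theorem eulerFactor_eq_one_of_dvd_modulus (f : CuspForm (Gamma0 N) 2) (χ : DirichletCharacter ℂ m)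
    {p : ℕ} (hp : p.Prime) (hpm : p ∣ m) (s : ℂ) :
    (1 - χ (p : ZMod m) * cuspCoeff f p * (p : ℂ) ^ (-s) +
        (if p ∣ N then 0 else (p : ℂ)) * χ (p : ZMod m) ^ 2 * ((p : ℂ) ^ (-s)) ^ 2) = 1 := by
  have hχ : χ (p : ZMod m) = 0 :=
    dirichletCharacter_apply_natCast_of_not_coprime χ
      (fun h => hp.one_lt.ne' (Nat.Coprime.eq_one_of_dvd h hpm))
  rw [hχ]
  ring


omit [NeZero N] in
/-- **A removed factor with `a_q = 0` at a prime of the level is `1`** — in particular at an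
ADDITIVE prime of `E` when `f` is its newform ("3-depletion is free at additive 3").
[cite: Kato2004Asterisque, §13.1 (13.1.1) (p. 224)] -/
theorem eulerFactor_eq_one_of_cuspCoeff_eq_zero (f : CuspForm (Gamma0 N) 2)
    (χ : DirichletCharacter ℂ m) {p : ℕ} (hap : cuspCoeff f p = 0) (hpN : p ∣ N) (s : ℂ) :
    (1 - χ (p : ZMod m) * cuspCoeff f p * (p : ℂ) ^ (-s) +
        (if p ∣ N then 0 else (p : ℂ)) * χ (p : ZMod m) ^ 2 * ((p : ℂ) ^ (-s)) ^ 2) = 1 := by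
  rw [hap, if_pos hpN]
  ring

omit [NeZero M] in
/-- **`a_p(f) = a_p(W) = 0` transfers along `IsNewformOf`**: if `f` is the newform of `W`
(`aₙ(f) = aₙ(W)`) and `a_p(W) = 0` — the case of an ADDITIVE prime `p` of `W`, by the tree's
`WeierstrassCurve.LFunction_apply_eq_zero_of_hasAdditiveReductionAt` (`RootNumberTwistProofs`) or
`WeierstrassCurve.LFunction_apply_eq_zero_of_not_good_of_not_mult` — then `a_p(f) = 0`, so the
removed factor at `p ∣ N` is `1` (`eulerFactor_eq_one_of_cuspCoeff_eq_zero`).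
[cite: SilvermanAEC2009, App. C §16 (the Euler factor at an additive prime is 1)] -/
theorem cuspCoeff_eq_zero_of_LFunction_eq_zero {W : WeierstrassCurve ℚ}
    {f : CuspForm (Gamma0 N) 2} (hf : IsNewformOf W f) {p : ℕ} (hap : W.LFunction p = 0) :
    cuspCoeff f p = 0 := by
  rw [hf.2 p, hap, Int.cast_zero]

omit [NeZero M] in
/-- **The removed factor at an additive prime is `1`, curve currency** (r1 GEN 42 (L2): at `p = 3`
additive for `E`, `a₃(E) = 0` and `3 ∣ N`, so PK-6-m1 strips only the `A`-factors): `f` the newform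
of `W`, `a_p(W) = 0` (tree: `LFunction_apply_eq_zero_of_hasAdditiveReductionAt`) and `p ∣ N`
(displayed; `N = N_W` is the named fact `IsNewformOf.level_eq_conductorNorm`, not used here).
[cite: SilvermanAEC2009, App. C §16 (the Euler factor at an additive prime is 1)] -/
theorem eulerFactor_eq_one_of_LFunction_eq_zero {W : WeierstrassCurve ℚ}
    {f : CuspForm (Gamma0 N) 2} (hf : IsNewformOf W f) (χ : DirichletCharacter ℂ m) {p : ℕ}
    (hap : W.LFunction p = 0) (hpN : p ∣ N) (s : ℂ) :
    (1 - χ (p : ZMod m) * cuspCoeff f p * (p : ℂ) ^ (-s) +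
        (if p ∣ N then 0 else (p : ℂ)) * χ (p : ZMod m) ^ 2 * ((p : ℂ) ^ (-s)) ^ 2) = 1 :=
  eulerFactor_eq_one_of_cuspCoeff_eq_zero f χ (cuspCoeff_eq_zero_of_LFunction_eq_zero hf hap) hpN s

omit [NeZero N] in
/-- **A removed factor at a prime `q ∤ N` with `χ(q) = 1` equals `(q + 1 − a_q)/q` at `s = 1`** —
for `f` the newform of `E` this is `#Ẽ(𝔽_q)/q`, the augmentation of Kato's depletion element
`1 − a_q q⁻¹σ_q⁻¹ + q⁻¹σ_q⁻²` at `q ∣ A` ((13.1.1)). [cite: Kato2004Asterisque, §13.1 (13.1.1) (p. 224)] -/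
theorem eulerFactor_one_eq_card_div (f : CuspForm (Gamma0 N) 2) (χ : DirichletCharacter ℂ m)
    {p : ℕ} (hp : p.Prime) (hpN : ¬ p ∣ N) (hχ : χ (p : ZMod m) = 1) :
    (1 - χ (p : ZMod m) * cuspCoeff f p * (p : ℂ) ^ (-(1 : ℂ)) +
        (if p ∣ N then 0 else (p : ℂ)) * χ (p : ZMod m) ^ 2 * ((p : ℂ) ^ (-(1 : ℂ))) ^ 2) =
      ((p : ℂ) + 1 - cuspCoeff f p) / (p : ℂ) := by
  have hp0 : (p : ℂ) ≠ 0 := Nat.cast_ne_zero.mpr hp.ne_zero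
  rw [hχ, if_neg hpN, cpow_neg_one]
  field_simp
  ring

/-! ### §4. Rational form of the removed factors (PK-6-m1's `hdepl`) -/

omit [NeZero M] in
/-- **A removed factor with `χ(q) = 1` is the RATIONAL number `1 − a_q(W)/q + 𝟙_N(q)/q` at `s = 1`**
when `f` is the newform of `W` (`a_q(f) = a_q(W) ∈ ℤ`). [folklore] -/
theorem eulerFactor_one_eq_ratCast {W : WeierstrassCurve ℚ} {f : CuspForm (Gamma0 N) 2}
    (hf : IsNewformOf W f) (χ : DirichletCharacter ℂ m) {p : ℕ} (hp : p.Prime)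
    (hχ : χ (p : ZMod m) = 1) :
    (1 - χ (p : ZMod m) * cuspCoeff f p * (p : ℂ) ^ (-(1 : ℂ)) +
        (if p ∣ N then 0 else (p : ℂ)) * χ (p : ZMod m) ^ 2 * ((p : ℂ) ^ (-(1 : ℂ))) ^ 2) =
      (((1 - (W.LFunction p : ℚ) / p + if p ∣ N then 0 else (1 : ℚ) / p : ℚ)) : ℂ) := by
  have hp0 : (p : ℂ) ≠ 0 := Nat.cast_ne_zero.mpr hp.ne_zero
  rw [hχ, hf.2 p, cpow_neg_one]
  by_cases hpN : p ∣ N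
  · rw [if_pos hpN, if_pos hpN]
    push_cast
    field_simp
    ring
  · rw [if_neg hpN, if_neg hpN]
    push_cast
    field_simp

/-- **PK-6-m1's depletion hypothesis, discharged in RATIONAL form.** For `f` the newform of `W`, an
entire `L` with `IsDepletedTwistedL f 1 M 1 L` and an entire continuation `L₀` of `L(f, s)`:
`L 1 = (E : ℂ) · L₀ 1` with the RATIONAL number `E = ∏_{q ∣ M} (1 − a_q(W)/q + 𝟙_N(q)/q)` (p13's
displayed `hdepl : LA 1 = (E : ℂ) * Lf 1`; `E ≠ 0` / `ord_p E = 0` stay the row's certificates —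
no unit claim here). [cite: Kato2004Asterisque, §6.2 (p. 161) and Ex. 13.3 (p. 225)] -/
theorem depletedTwistedL_one_eq_ratCast_prod_mul {W : WeierstrassCurve ℚ} {f : CuspForm (Gamma0 N) 2}
    (hf : IsNewformOf W f) {L L₀ : ℂ → ℂ}
    (hS : EulerSystemValues.IsDepletedTwistedL f 1 M (1 : DirichletCharacter ℂ 1) L)
    (hL₀ : Differentiable ℂ L₀) (hL₀s : ∀ s : ℂ, 2 < s.re → L₀ s = cuspFormLSeries f s) :
    L 1 = ((∏ p ∈ M.primeFactors,
        (1 - (W.LFunction p : ℚ) / p + if p ∣ N then 0 else (1 : ℚ) / p) : ℚ) : ℂ) * L₀ 1 := by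
  rw [depletedTwistedL_one_eq_trivial hf.1 hS hL₀ hL₀s, Rat.cast_prod]
  congr 1
  refine Finset.prod_congr rfl fun p hp => ?_
  have h := eulerFactor_one_eq_ratCast (m := 1) hf (1 : DirichletCharacter ℂ 1)
    (Nat.prime_of_mem_primeFactors hp) (MulChar.one_apply (isUnit_of_subsingleton _))
  rw [MulChar.one_apply (isUnit_of_subsingleton _)] at h
  simpa only [one_mul, one_pow, mul_one] using h

/-- **The same with the additive prime's factor removed** (`M = p·A`, `a_p(W) = 0`, `p ∣ N`: the
`p`-factor is `1`, so only the `A`-factors remain — T-PORT-1-PKIM (S5) / r1 GEN 42 (L2)).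
[cite: Kato2004Asterisque, §13.1 (13.1.1) and Ex. 13.3 (pp. 224–225)] -/
theorem depletedTwistedL_one_eq_ratCast_prod_mul_of_apZero {W : WeierstrassCurve ℚ}
    {f : CuspForm (Gamma0 N) 2} (hf : IsNewformOf W f) {p A : ℕ} (hp : p.Prime) [NeZero A]
    (hap : W.LFunction p = 0) (hpN : p ∣ N) {L L₀ : ℂ → ℂ}
    (hS : EulerSystemValues.IsDepletedTwistedL f 1 (p * A) (1 : DirichletCharacter ℂ 1) L)
    (hL₀ : Differentiable ℂ L₀) (hL₀s : ∀ s : ℂ, 2 < s.re → L₀ s = cuspFormLSeries f s) :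
    L 1 = ((∏ q ∈ A.primeFactors,
        (1 - (W.LFunction q : ℚ) / q + if q ∣ N then 0 else (1 : ℚ) / q) : ℚ) : ℂ) * L₀ 1 := by
  haveI : NeZero (p * A) := ⟨mul_ne_zero hp.ne_zero (NeZero.ne A)⟩
  rw [depletedTwistedL_one_eq_ratCast_prod_mul hf hS hL₀ hL₀s]
  congr 2
  -- the factor at `p` is `1`, so it may be dropped from / added to the index set
  have h1 : (1 - (W.LFunction p : ℚ) / p + if p ∣ N then 0 else (1 : ℚ) / p) = 1 := by
    rw [hap, if_pos hpN]; simp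
  rw [Nat.primeFactors_mul hp.ne_zero (NeZero.ne A), hp.primeFactors]
  by_cases hpA : p ∈ A.primeFactors
  · rw [Finset.union_eq_right.mpr (Finset.singleton_subset_iff.mpr hpA)]
  · rw [Finset.prod_union (Finset.disjoint_singleton_left.mpr hpA), Finset.prod_singleton, h1,
      one_mul]

end Summit.BirchSwinnertonDyer.Rank1Residual.GaloisImage.DepletedLValue

end
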